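import Summits.ValiantsHypothesis.ValiantsHypothesis.Theorems.SymPencilBoxFourCrossOf
import Summits.ValiantsHypothesis.ValiantsHypothesis.Theorems.SymPencilBoxFourSevenSmall
import Summits.ValiantsHypothesis.ValiantsHypothesis.Theorems.SymPencilPerFourCrossRadical

/-!
# Route `SymPencil` — the `7`-dimensional linear subspaces of `Sing Z(per_4)`: the trichotomy
# (`--supports` stmt-ValiantsHypothesis-5674 `SdcSuperquadratic`; rung currency only)

**Trichotomy** (`seven_trichotomy`, any field of characteristic `0`).  A `7`-dimensional linear
space `W` of `4 × 4` matrices on which all `3 × 3` minor-permanents vanish (a `7`-dimensional linear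
subspace of `Sing Z(per_4)`) has a DETECTING pair of rows (some `p ≠ q` such that `x ∈ W` with rows
`p, q` zero forces `x = 0`), or a detecting pair of columns, or is contained in (hence equal to) a
CROSS `X_{lc} = {support ⊂ row l ∪ column c}`.  (Files: `SymPencilBoxFourSevenProfile/Filtration`
— the row filtration in dimension `7`; `SymPencilBoxFourCross/CrossLe/CrossOf` — a row of dimension
`≥ 3` without detecting pairs forces a cross; `SymPencilBoxFourSevenSmall` — rows of dimension
`≤ 2` force a detecting pair of columns.)

**Consequence** (`noSqFamily_seven`): no `7`-dimensional `V ⊆ Sing Z(per_4)` carries, for fixed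
weights `c : Fin k → K` with `k ≤ 5`, a `k`-square expansion of the `s²`-coefficient of
`per_4 (u + s y)` at every base point `u` — by the quantitative radical bounds `2 dim V ≤ k + 8` of
val-width-5674-p1 (`SymPencilPerFourDetectingRadical.not_sqFamily_of_detecting`,
`SymPencilPerFourCrossRadical.not_sqFamily_of_cross`).  The equality form
`seven_trichotomy_iff` is the hypothesis `T7` of val-width-5674-p1's
`SymPencilSdcPerFourTwentyFiveOfSeven.twentyFive_le_of_seven_trichotomy` (on val-width-5674-p2's
two-sided kernel package), which turns it into the rung `sdc(per_4) ≥ 25` — the ceiling of the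
kernel-rows / second-moment method (the rungs `≥ 21`, `≥ 23` are `SymPencilSdcPerFourTwentyOne/
TwentyThree`).

HONEST FRAMING: finite data points for `n = 4`.  The `6`-dimensional analogue of the trichotomy is
FALSE (`SymPencilPerFourSixDimExotic`, val-width-5674-p1: `row 0 ⊕ K(E₁₀+E₁₁) ⊕ K(E₂₀−E₂₁)`); the
crux `SdcSuperquadratic` is not touched and nothing here bears on `VP ≠ VNP`. [folklore]
-/

noncomputable section

-- single-conjunct layout: Sub = Summit, duplicated namespace component intended
set_option linter.dupNamespace false

namespace Summit.ValiantsHypothesis.ValiantsHypothesis.Theorems.SymPencilBoxFourSeven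

open Module Finset MvPolynomial
open Literature.Computability.AlgebraicComplexity
open Summit.ValiantsHypothesis.ValiantsHypothesis.Theorems.SymPencilBoxFourCrossOf
open Summit.ValiantsHypothesis.ValiantsHypothesis.Theorems.SymPencilBoxFourSevenSmall
open Summit.ValiantsHypothesis.ValiantsHypothesis.Theorems.SymPencilBoxFourEquality
open Summit.ValiantsHypothesis.ValiantsHypothesis.Theorems.SymPencilPerFourDetectingRadical
open Summit.ValiantsHypothesis.ValiantsHypothesis.Theorems.SymPencilPerFourCrossRadical

variable {K : Type*} [Field K] [CharZero K]

/-- **Trichotomy for `7`-dimensional linear subspaces of `Sing Z(per_4)`**: a detecting pair of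
rows, a detecting pair of columns, or containment in a cross. [folklore] -/
theorem seven_trichotomy (W : Submodule K (Fin 4 × Fin 4 → K))
    (hW : ∀ x ∈ W, ∀ (r c : Fin 3 → Fin 4), Function.Injective r → Function.Injective c →
      ((Matrix.of fun i j => x (i, j)).submatrix r c).permanent = 0)
    (h7 : finrank K W = 7) :
    (∃ p q : Fin 4, p ≠ q ∧ ∀ x ∈ W, (∀ j, x (p, j) = 0) → (∀ j, x (q, j) = 0) → x = 0) ∨
    (∃ p q : Fin 4, p ≠ q ∧ ∀ x ∈ W, (∀ i, x (i, p) = 0) → (∀ i, x (i, q) = 0) → x = 0) ∨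
    (∃ l c : Fin 4, ∀ x ∈ W, ∀ i j : Fin 4, i ≠ l → j ≠ c → x (i, j) = 0) := by
  by_cases hnr : ∃ p q : Fin 4, p ≠ q ∧ ∀ x ∈ W, (∀ j, x (p, j) = 0) → (∀ j, x (q, j) = 0) → x = 0
  · exact Or.inl hnr
  by_cases hnc : ∃ p q : Fin 4, p ≠ q ∧ ∀ x ∈ W, (∀ i, x (i, p) = 0) → (∀ i, x (i, q) = 0) → x = 0
  · exact Or.inr (Or.inl hnc)
  right; right
  by_cases h3 : ∃ l : Fin 4, 3 ≤ finrank K ↥(W.map (LinearMap.funLeft K K fun j : Fin 4 => (l, j)))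
  · exact le_cross_of_no_detecting W hW h7 hnr h3
  · push Not at h3
    exact (false_of_small_rows W hW h7 (fun l => Nat.le_of_lt_succ (h3 l)) hnc).elim

/-- The trichotomy with the hypothesis in the form of the sixteen `3 × 3` subpermanents
(rows `≠ r`, columns `≠ c`). [folklore] -/
theorem seven_trichotomy_of_subperm_three_vanish (W : Submodule K (Fin 4 × Fin 4 → K))
    (hW : ∀ x ∈ W, ∀ r c : Fin 4,
      ((Matrix.of fun i j => x (i, j)).submatrix r.succAbove c.succAbove).permanent = 0)
    (h7 : finrank K W = 7) :
    (∃ p q : Fin 4, p ≠ q ∧ ∀ x ∈ W, (∀ j, x (p, j) = 0) → (∀ j, x (q, j) = 0) → x = 0) ∨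
    (∃ p q : Fin 4, p ≠ q ∧ ∀ x ∈ W, (∀ i, x (i, p) = 0) → (∀ i, x (i, q) = 0) → x = 0) ∨
    (∃ l c : Fin 4, ∀ x ∈ W, ∀ i j : Fin 4, i ≠ l → j ≠ c → x (i, j) = 0) :=
  seven_trichotomy W (fun x hx r c hr hc =>
    subperm_vanish_inj_of_succAbove x (hW x hx) r c hr hc) h7

/-- **`H7ₖ` for `k ≤ 5`**: no `7`-dimensional linear subspace of `Sing Z(per_4)` carries a
`k`-square family of `s²`-coefficients with `k ≤ 5`. [folklore] -/
theorem noSqFamily_seven {k : ℕ} (hk : k ≤ 5) (V : Submodule K (Fin 4 × Fin 4 → K))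
    (hV : ∀ x ∈ V, ∀ (r c : Fin 3 → Fin 4), Function.Injective r → Function.Injective c →
      ((Matrix.of fun i j => x (i, j)).submatrix r c).permanent = 0)
    (h7 : finrank K V = 7) (c : Fin k → K) :
    ¬ (∀ u : Fin 4 × Fin 4 → K, ∃ Λ : Fin k → ((Fin 4 × Fin 4 → K) →ₗ[K] K),
        ∀ y ∈ V, ∃ e₀ e₁ : K, ∀ s : K,
          eval (u + s • y) (perPoly (Fin 4) K) = e₀ + s * e₁ + s ^ 2 * ∑ k, c k * (Λ k y) ^ 2) := by
  have hlt : Fintype.card (Fin k) + 8 < 2 * finrank K V := by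
    rw [Fintype.card_fin, h7]; omega
  rcases seven_trichotomy V hV h7 with hdet | hdet | hX
  · exact not_sqFamily_of_detecting V hV (Or.inl hdet) hlt c
  · exact not_sqFamily_of_detecting V hV (Or.inr hdet) hlt c
  · exact not_sqFamily_of_cross V hX hlt c

/-- **Trichotomy, equality form**: the third case is `W =` a cross (as sets), since a cross has
dimension `≤ 7 = dim W`.  This is the shape `T7` consumed by
`SymPencilSdcPerFourTwentyFiveOfSeven.twentyFive_le_of_seven_trichotomy` (val-width-5674-p1).
[folklore] -/
theorem seven_trichotomy_iff (W : Submodule K (Fin 4 × Fin 4 → K))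
    (hW : ∀ x ∈ W, ∀ (r c : Fin 3 → Fin 4), Function.Injective r → Function.Injective c →
      ((Matrix.of fun i j => x (i, j)).submatrix r c).permanent = 0)
    (h7 : finrank K W = 7) :
    (∃ p q : Fin 4, p ≠ q ∧ ∀ x ∈ W, (∀ j, x (p, j) = 0) → (∀ j, x (q, j) = 0) → x = 0) ∨
    (∃ p q : Fin 4, p ≠ q ∧ ∀ x ∈ W, (∀ i, x (i, p) = 0) → (∀ i, x (i, q) = 0) → x = 0) ∨
    (∃ l c : Fin 4, ∀ x, x ∈ W ↔ ∀ i j : Fin 4, i ≠ l → j ≠ c → x (i, j) = 0) := by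
  classical
  rcases seven_trichotomy W hW h7 with h | h | ⟨l, c, hX⟩
  · exact Or.inl h
  · exact Or.inr (Or.inl h)
  right; right
  refine ⟨l, c, ?_⟩
  -- the cross as a submodule, of dimension `≤ 7`
  let S := {p : Fin 4 × Fin 4 // p.1 ≠ l ∧ p.2 ≠ c}
  let X : Submodule K (Fin 4 × Fin 4 → K) :=
    ⨅ p : S, LinearMap.ker (LinearMap.proj (p : Fin 4 × Fin 4) : (Fin 4 × Fin 4 → K) →ₗ[K] K)
  have memX : ∀ x, x ∈ X ↔ ∀ i j : Fin 4, i ≠ l → j ≠ c → x (i, j) = 0 := by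
    intro x
    simp only [X, Submodule.mem_iInf, LinearMap.mem_ker, LinearMap.coe_proj, Function.eval]
    constructor
    · intro h i j hi hj
      exact h ⟨(i, j), hi, hj⟩
    · rintro h ⟨⟨i, j⟩, hi, hj⟩
      exact h i j hi hj
  have hWX : W ≤ X := fun x hx => (memX x).2 (hX x hx)
  -- restriction to the `7` cross cells is injective on `X`
  let C := {p : Fin 4 × Fin 4 // p.1 = l ∨ p.2 = c}
  have hC : Fintype.card C = 7 := by
    have key : ∀ l c : Fin 4,
        (Finset.univ.filter fun p : Fin 4 × Fin 4 => p.1 = l ∨ p.2 = c).card = 7 := by decide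
    rw [Fintype.card_subtype]
    exact key l c
  let res : (Fin 4 × Fin 4 → K) →ₗ[K] (C → K) := LinearMap.funLeft K K (fun p : C => (p : Fin 4 × Fin 4))
  have hinj : Function.Injective (res.domRestrict X) := by
    refine LinearMap.ker_eq_bot.1 (LinearMap.ker_eq_bot'.2 fun x hx => ?_)
    have hxX := (memX x).1 x.2
    apply Subtype.ext
    funext ⟨i, j⟩
    by_cases hij : i = l ∨ j = c
    · have := congr_fun hx ⟨(i, j), hij⟩
      exact this
    · push Not at hij
      exact hxX i j hij.1 hij.2
  have hX7 : finrank K X ≤ 7 := by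
    have h := LinearMap.finrank_le_finrank_of_injective hinj
    rwa [finrank_fintype_fun_eq_card, hC] at h
  have hEq : W = X := Submodule.eq_of_le_of_finrank_le hWX (by rw [h7]; exact hX7)
  intro x
  rw [hEq]
  exact memX x

end Summit.ValiantsHypothesis.ValiantsHypothesis.Theorems.SymPencilBoxFourSeven

end
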